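import Summits.QuantumFields.YangMills.Theorems.BalabanLadderIRReflectedAntipodal
import Summits.QuantumFields.YangMills.Theorems.BalabanLadderIRRankPurityCofinalDefs
import HarnessLib

/-!
# Crux `BalabanLadder.IRcof` (stmt-QuantumFields-26930) ∕ residual `IRnscCof`: the cofinal leaf IS reflected antipodal mirror decay on a cofinal set
# (ideator ym-ir-idea-14 gen 4, LINE E part R-cof; helper for stmt-QuantumFields-19354 ∕ 26930)

HONEST STATUS.  Reflection-positivity bookkeeping only (the cofinal companion of `BalabanLadderIRReflectedAntipodal`): an EQUIVALENT
re-typing of the nsc conjunct `IRnscCof` of the cofinal leaf.  Nothing here proves `IRcof` (26930), `IR` (19354), `IRnscCof`, `IRnsc`,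
any lattice mass gap or the Clay Yang–Mills problem (R4 = `BalabanLadder.UV` only).

CONTENT: `GapOn G r a Bset` (the clustering family of `GapInUnits` asked for `β ∈ Bset` only) ⟺ `ReflectedAntipodalDecayOn G r a Bset`
(`gapOn_iff_reflectedAntipodalOn`, every compact `G`, positive unit map `a → 0`, ANY coupling set); hence
`IRnscCof_iff_reflected : IRnscCof ↔ IRnscCofRefl` — the cofinal residual N_cof IS «reflected antipodal mirror decay in floor units on a
cofinal set of couplings».  Proof: the rate-uniform single-torus reduction `abs_latticeConnectedCorr_le_of_reflected_uniform` of part R,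
applied coupling by coupling.
-/

open MeasureTheory Filter Topology
open Literature.MathematicalPhysics.QuantumFieldTheory Literature.MathematicalPhysics.QuantumLattice
open Summit.QuantumFields.YangMills.Theorems.SoloBlind
open Summit.QuantumFields.YangMills.Cruxes.OSLegsFromFemtoAndGap.DlrCollarTransfer (GapInUnits LowerBounds)
open Summit.QuantumFields.YangMills.Cruxes.IR.RankPurity (IRnscCof)

noncomputable section

namespace Summit.QuantumFields.YangMills.Cruxes.IR.ReflectedAntipodal

variable {G : Type} [Group G] [TopologicalSpace G] [IsTopologicalGroup G] [CompactSpace G]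
  [MeasurableSpace G] [BorelSpace G]

section Units
variable (G) (r : LatticeRep G) (a : ℝ → ℝ) (Bset : Set ℝ)

/-- **`GapOn` — the clustering family of `GapInUnits G r a` asked only for couplings `β ∈ Bset`** (verbatim otherwise). -/
def GapOn : Prop :=
  ∃ (c₁ β₂ : ℝ) (S₁ : ℝ → ℕ), 0 < c₁ ∧ ∀ A B : YMSpecies G, ∃ C : ℝ, ∀ β ∈ Bset, β₂ ≤ β →
    ∀ S n : ℕ, S₁ β ≤ S → n ≤ S →
      |latticeConnectedCorr r.ρ β (2 * S + 1) A.F B.F n| ≤ C * Real.exp (-(c₁ * a β * n))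

/-- **Reflected antipodal mirror decay on the coupling set `Bset`** (one species, one separation; `ReflectedAntipodalDecay` asked
only for `β ∈ Bset`). -/
def ReflectedAntipodalDecayOn : Prop :=
  ∃ (c₁ β₂ : ℝ) (S₁ : ℝ → ℕ), 0 < c₁ ∧ ∀ A : YMSpecies G, ∃ C : ℝ, ∀ β ∈ Bset, β₂ ≤ β → ∀ S : ℕ, S₁ β ≤ S →
    latticeConnectedCorr r.ρ β (2 * S + 1) A.timeReflect.F A.F S ≤ C * Real.exp (-(c₁ * a β * S)) ∧
      latticeConnectedCorr r.ρ β (2 * S + 1) A.F A.timeReflect.F S ≤ C * Real.exp (-(c₁ * a β * S))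

end Units

section Equivalence
variable {r : LatticeRep G} {a : ℝ → ℝ}

/-- The trivial direction on a coupling set. -/
theorem reflectedAntipodalOn_of_gapOn {Bset : Set ℝ} (h : GapOn G r a Bset) : ReflectedAntipodalDecayOn G r a Bset := by
  obtain ⟨c₁, β₂, S₁, hc₁, hAB⟩ := h
  refine ⟨c₁, β₂, S₁, hc₁, fun A => ?_⟩
  obtain ⟨C₁, hC₁⟩ := hAB A.timeReflect A
  obtain ⟨C₂, hC₂⟩ := hAB A A.timeReflect
  refine ⟨max C₁ C₂, fun β hβB hβ S hS => ⟨?_, ?_⟩⟩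
  · exact ((le_abs_self _).trans (hC₁ β hβB hβ S S hS le_rfl)).trans
      (mul_le_mul_of_nonneg_right (le_max_left _ _) (Real.exp_pos _).le)
  · exact ((le_abs_self _).trans (hC₂ β hβB hβ S S hS le_rfl)).trans
      (mul_le_mul_of_nonneg_right (le_max_right _ _) (Real.exp_pos _).le)

/-- **The reduction on a coupling set: reflected antipodal mirror decay on `Bset` implies the clustering family on `Bset`**
(every compact `G`, positive unit map `a → 0`; the rate-uniform single-torus reduction of part R, coupling by coupling). -/
theorem gapOn_of_reflectedAntipodalOn {Bset : Set ℝ} (ha : ∀ β, 0 < a β) (ha0 : Tendsto a atTop (𝓝 0))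
    (h : ReflectedAntipodalDecayOn G r a Bset) : GapOn G r a Bset := by
  obtain ⟨c₁, β₂, S₁, hc₁, hA⟩ := h
  -- eventually `a β ≤ 1`
  obtain ⟨βa, hβa⟩ : ∃ βa : ℝ, ∀ β, βa ≤ β → a β ≤ 1 := by
    have hev : ∀ᶠ β in atTop, a β < 1 := ha0.eventually (eventually_lt_nhds zero_lt_one)
    obtain ⟨βa, h⟩ := Filter.eventually_atTop.1 hev
    exact ⟨βa, fun β hβ => (h β hβ).le⟩
  refine ⟨c₁, max (max β₂ βa) 0, S₁, hc₁, fun A B => ?_⟩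
  obtain ⟨TA', TA, hsA⟩ := exists_isSlabSupported A
  obtain ⟨TB', TB, hsB⟩ := exists_isSlabSupported B
  obtain ⟨a0, ha0'⟩ := A.bounded
  obtain ⟨b0, hb0'⟩ := B.bounded
  obtain ⟨CA, hCA⟩ := hA A
  obtain ⟨CB, hCB⟩ := hA B
  set SAB : ℕ := 2 * (TA + TA' + TB + TB') + 2 with hSAB
  refine ⟨max (Kref c₁ CA CB a0 b0 TA TB') (2 * (a0 * b0) * Real.exp (c₁ * SAB)), fun β hβB hβ S n hS hn => ?_⟩
  have hβ2 : β₂ ≤ β := le_trans (le_max_left _ _) ((le_max_left _ _).trans hβ)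
  have hβa' : βa ≤ β := le_trans (le_max_right _ _) ((le_max_left _ _).trans hβ)
  have hβ0 : 0 ≤ β := (le_max_right _ _).trans hβ
  have ha1 : a β ≤ 1 := hβa β hβa'
  have haβ : 0 ≤ a β := (ha β).le
  have hμ : 0 ≤ c₁ * a β := mul_nonneg hc₁.le haβ
  have hμ₀ : c₁ * a β ≤ c₁ := by nlinarith
  have hexp0 : 0 ≤ Real.exp (-(c₁ * a β * n)) := (Real.exp_pos _).le
  by_cases hSl : SAB ≤ S
  · have key := abs_latticeConnectedCorr_le_of_reflected_uniform r.ρ r.continuous hβ0 hsA hsB ha0' hb0' hμ hμ₀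
      CA CB hSl (hCA β hβB hβ2 S hS).1 (hCA β hβB hβ2 S hS).2 (hCB β hβB hβ2 S hS).1 (hCB β hβB hβ2 S hS).2 hn
    have e1 : Real.exp (-(c₁ * a β * (n : ℝ))) = Real.exp (-(c₁ * a β * n)) := rfl
    calc |latticeConnectedCorr r.ρ β (2 * S + 1) A.F B.F n|
        ≤ Kref c₁ CA CB a0 b0 TA TB' * Real.exp (-(c₁ * a β * n)) := by simpa [mul_assoc] using key
      _ ≤ max (Kref c₁ CA CB a0 b0 TA TB') (2 * (a0 * b0) * Real.exp (c₁ * SAB)) * Real.exp (-(c₁ * a β * n)) :=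
          mul_le_mul_of_nonneg_right (le_max_left _ _) hexp0
  · push Not at hSl
    have hsmall := abs_latticeConnectedCorr_le r.ρ r.continuous β S A B ha0' hb0' n
    have hab : 0 ≤ 2 * (a0 * b0) := (abs_nonneg _).trans hsmall
    -- `c₁ a β n ≤ c₁ S_{AB}` since `a β ≤ 1`, `n ≤ S < S_{AB}`
    have hnS : (n : ℝ) ≤ SAB := by exact_mod_cast (hn.trans hSl.le)
    have h1 : 1 ≤ Real.exp (c₁ * SAB) * Real.exp (-(c₁ * a β * n)) := by
      rw [← Real.exp_add]
      apply Real.one_le_exp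
      have h2 : c₁ * a β * (n : ℝ) ≤ c₁ * 1 * SAB := by
        have h3 : c₁ * a β * (n : ℝ) ≤ c₁ * a β * SAB := mul_le_mul_of_nonneg_left hnS hμ
        have h4 : c₁ * a β * (SAB : ℝ) ≤ c₁ * 1 * SAB :=
          mul_le_mul_of_nonneg_right (by nlinarith) (Nat.cast_nonneg _)
        linarith
      linarith
    calc |latticeConnectedCorr r.ρ β (2 * S + 1) A.F B.F n|
        ≤ 2 * (a0 * b0) := hsmall
      _ ≤ 2 * (a0 * b0) * (Real.exp (c₁ * SAB) * Real.exp (-(c₁ * a β * n))) := le_mul_of_one_le_right hab h1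
      _ = 2 * (a0 * b0) * Real.exp (c₁ * SAB) * Real.exp (-(c₁ * a β * n)) := by ring
      _ ≤ max (Kref c₁ CA CB a0 b0 TA TB') (2 * (a0 * b0) * Real.exp (c₁ * SAB)) * Real.exp (-(c₁ * a β * n)) :=
          mul_le_mul_of_nonneg_right (le_max_right _ _) hexp0

/-- **`GapOn` is reflected antipodal mirror decay on the same coupling set.** -/
theorem gapOn_iff_reflectedAntipodalOn {Bset : Set ℝ} (ha : ∀ β, 0 < a β) (ha0 : Tendsto a atTop (𝓝 0)) :
    GapOn G r a Bset ↔ ReflectedAntipodalDecayOn G r a Bset :=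
  ⟨reflectedAntipodalOn_of_gapOn, gapOn_of_reflectedAntipodalOn ha ha0⟩

end Equivalence

/-! ## The cofinal residual, re-typed -/

/-- **`IRnscCofRefl` — the cofinal nsc conjunct `IRnscCof` with its conclusion restricted to the reflected mirror pairs at the
antipode** (compact simple `G`, `π₁(G) ≠ 1`; floors ⇒ a cofinal coupling set carrying reflected antipodal mirror decay). -/
def IRnscCofRefl : Prop :=
  ∀ (G : Type) [Group G] [TopologicalSpace G] [IsTopologicalGroup G] [CompactSpace G],
    IsCompactSimpleLieGroup G → ¬ SimplyConnectedSpace G →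
    letI : MeasurableSpace G := borel G
    haveI : BorelSpace G := ⟨rfl⟩
    ∀ (r : LatticeRep G) (a : ℝ → ℝ), (∀ β, 0 < a β) → Tendsto a atTop (𝓝 0) → LowerBounds G r a →
      ∃ Bset : Set ℝ, (∀ x : ℝ, ∃ β ∈ Bset, x ≤ β) ∧ ReflectedAntipodalDecayOn G r a Bset

/-- **The cofinal residual N_cof (`IRnscCof`) IS reflected antipodal mirror decay on a cofinal coupling set** (PROVED equivalence;
RP bookkeeping, no decay produced). -/
theorem IRnscCof_iff_reflected : IRnscCof ↔ IRnscCofRefl := by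
  constructor
  · intro h G _ _ _ _ hG hns
    letI : MeasurableSpace G := borel G
    haveI : BorelSpace G := ⟨rfl⟩
    intro r a ha ha0 hlb
    obtain ⟨Bset, hcof, hgap⟩ := h G hG hns r a ha ha0 hlb
    exact ⟨Bset, hcof, reflectedAntipodalOn_of_gapOn hgap⟩
  · intro h G _ _ _ _ hG hns
    letI : MeasurableSpace G := borel G
    haveI : BorelSpace G := ⟨rfl⟩
    intro r a ha ha0 hlb
    obtain ⟨Bset, hcof, hre⟩ := h G hG hns r a ha ha0 hlb
    exact ⟨Bset, hcof, gapOn_of_reflectedAntipodalOn ha ha0 hre⟩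

end Summit.QuantumFields.YangMills.Cruxes.IR.ReflectedAntipodal

end
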